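import Literature.NumberTheory.EllipticCurves.PastenHeightBoundsGRHProofs
import Literature.NumberTheory.EllipticCurves.ModularDegreeGRHBoundProofs
import Literature.NumberTheory.EllipticCurves.ModularCurveNeronLatticeProofs
import HarnessLib

/-!
# `log c ≪ φ(rad(abc)) · log log rad(abc)` under GRH, from Pasten's Thm 7.7 (GRH) through the
# Frey–Hellegouarch curve (proofs)

Topic `Literature/NumberTheory/EllipticCurves` (family `abc`, LADDER-ABC A1, the *modular method*;
cell abc-stewartyu, seat lit-abc-pasten g5). Theorems only — NO new statement, NO new named fact
(D-0026). Companion of `PastenHeightBoundsGRH.lean` (named fact `PastenShimura2024_thm_7_7_grh`) and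
`PastenHeightBoundsGRHProofs.lean` (`PastenShimura2024_cor_7_8_grh`: Cor 7.8, GRH branch, PROVED from
it). Source: H. Pasten, *Shimura curves and the abc conjecture*, J. Number Theory **254** (2024) =
arXiv:1705.09251v4 [`PastenShimura2024`], Cor 7.8 (p. 27) and §3 (Frey–Hellegouarch curves, p. 13).

* `abc_log_le_totient_rad_mul_loglog_of_thm_7_7_grh` — granted `PastenShimura2024_thm_7_7_grh` and
  ASSUMING GRH for all Rankin–Selberg pairs of weight-`2` newforms (hypothesis `hGRH`):
  `∃ c₀, ∀ abc triples with c ≥ c₀, log c ≤ 2051 · φ(rad(abc)) · log log rad(abc)`. Proof: Cor 7.8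
  (GRH) at `S = {2}` (`P/φ(P) = 2`), `ε = 1/2`, applied to a global minimal model of the Frey model of
  `exists_frey_model_sq_dvd` (`N ∣ 2¹⁰ rad`, `(abc)² ∣ 2⁸ |Δ_min|`, semistable away from `2` by
  `isSemistableAt_of_dvd_two_pow_mul`, Néron lattice by `exists_isNeronLatticeOf_holds`):
  `log|Δ_min| < 2 φ(N) log log N` once `N ≥ N₀` — forced, as in the sibling
  `exists_abc_log_le_of_discriminant_loglogBound`, by a prime factor `p ≥ 2 max(N₀ + 2, 512)` of
  `abc` (Mahler's finiteness `finite_setOf_isABCTriple_primeFactors_subset_holds` excludes the other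
  triples through `c₀`); then `φ(N) ≤ 2¹⁰ φ(rad)` (`Nat.totient_dvd_of_dvd`, `φ(2¹⁰ r) ≤ 2¹⁰ φ(r)`),
  `log log N ≤ 2 log log rad`, `4 log 2 ≤ 3 φ(rad) log log rad`.
  Sharper than the `D = 1` GRH rung `log c ≤ 1537 · rad · log log rad`
  (`abc_log_le_mul_rad_mul_loglog_of_grh_of_thm_7_3`) by the factor `φ(rad)/rad`; NOT a printed display
  (the Frey translation and the constant are ours); still exponential in `rad`; no claim on `abc`.

## References

* [PastenShimura2024] H. Pasten, J. Number Theory 254 (2024) = arXiv:1705.09251v4: §3 p. 13, Cor 7.8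
  (GRH clauses) p. 27.
* [MurtyPasten2013] M. R. Murty, H. Pasten, J. Number Theory 133 (2013), §8 (Frey-curve translation).
-/

noncomputable section

open scoped MatrixGroups ModularForm

open WeierstrassCurve IsDedekindDomain Finset Rat.HeightOneSpectrum CongruenceSubgroup

namespace Literature.NumberTheory.EllipticCurves.ModularForms

/-! ### The `abc` consequence: `log c ≪ φ(rad) · log log rad` under GRH -/

section Abc

open UniqueFactorizationMonoid Literature.NumberTheory.DiophantineGeometry

/-- The rational prime below the place `primesEquiv.symm p` is `p`. [folklore] -/
private theorem natGenerator_primesEquiv_symm'' (p : Nat.Primes) :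
    natGenerator ((primesEquiv (R := ℤ)).symm p) = p :=
  congrArg Subtype.val ((primesEquiv (R := ℤ)).apply_symm_apply p)

/-- Over `ℤ`: `N(𝔭) = p` for the place above the rational prime `p`. [folklore] -/
private theorem absNorm_asIdeal_primesEquiv_symm (p : Nat.Primes) :
    Ideal.absNorm ((primesEquiv (R := ℤ)).symm p).asIdeal = p := by
  set v := (primesEquiv (R := ℤ)).symm p with hv
  have h : v.asIdeal = Ideal.span {(natGenerator v : ℤ)} := by
    rw [span_natGenerator, ← Ideal.comap_symm]
    ext x
    rw [Ideal.mem_comap, eq_intCast, Int.cast_id]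
  rw [h, Ideal.absNorm_span_natCast, Module.finrank_self, pow_one, hv, natGenerator_primesEquiv_symm'']

/-- `φ(2¹⁰ r) ≤ 2¹⁰ φ(r)` for squarefree `r`. [folklore] -/
private theorem totient_two_pow_mul_le {r : ℕ} (hr : Squarefree r) :
    Nat.totient (2 ^ 10 * r) ≤ 2 ^ 10 * Nat.totient r := by
  by_cases h2 : 2 ∣ r
  · obtain ⟨r', rfl⟩ := h2
    have hr' : ¬ 2 ∣ r' := fun h ↦ by
      have : 2 * 2 ∣ 2 * r' := Nat.mul_dvd_mul_left 2 h
      exact absurd (hr 2 this) (by decide)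
    have hc11 : Nat.Coprime (2 ^ 11) r' :=
      Nat.Coprime.pow_left 11 (Nat.prime_two.coprime_iff_not_dvd.2 hr')
    have hc1 : Nat.Coprime 2 r' := Nat.prime_two.coprime_iff_not_dvd.2 hr'
    have e1 : 2 ^ 10 * (2 * r') = 2 ^ 11 * r' := by ring
    rw [e1, Nat.totient_mul hc11, Nat.totient_mul hc1, Nat.totient_prime_pow Nat.prime_two (by norm_num),
      Nat.totient_prime Nat.prime_two]
    norm_num
  · have hc : Nat.Coprime (2 ^ 10) r :=
      Nat.Coprime.pow_left 10 (Nat.prime_two.coprime_iff_not_dvd.2 h2)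
    rw [Nat.totient_mul hc, Nat.totient_prime_pow Nat.prime_two (by norm_num)]
    norm_num
    omega

/-- **`log c ≪ φ(rad(abc)) · log log rad(abc)` under GRH** (the `abc` form of Pasten's Cor 7.8, GRH
branch, through the Frey–Hellegouarch curve — semistable away from `S = {2}`, `P/φ(P) = 2`): granted
`PastenShimura2024_thm_7_7_grh` and ASSUMING GRH for all Rankin–Selberg pairs of weight-`2` newforms,
there is `c₀` such that every `abc` triple with `c ≥ c₀` satisfies
`log c ≤ 2051 · φ(rad(abc)) · log log rad(abc)`. Proof: a global minimal model `W` of the Frey model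
`W₀` of `exists_frey_model_sq_dvd` (`N ∣ 2¹⁰ rad`, `(abc)² ∣ 2⁸|Δ_min|`), a Néron lattice
(`exists_isNeronLatticeOf_holds`), semistability away from `2` from `N ∣ 2¹⁰ rad`, Cor 7.8 (GRH) at
`ε = 1/2`: `log|Δ_min| < 2 φ(N) log log N` once `N ≥ N₀` (forced, as in
`exists_abc_log_le_of_discriminant_loglogBound`, by a prime factor `p ≥ 2 max(N₀ + 2, 512)` of `abc`,
Mahler's finiteness excluding the other triples through `c₀`); then `φ(N) ≤ 2¹⁰ φ(rad)`,
`log log N ≤ 2 log log rad`, `4 log 2 ≤ 3 φ(rad) log log rad`. Sharper than the sibling rung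
`log c ≤ 1537 rad log log rad` by the factor `φ(rad)/rad`; still exponential; GRH is a hypothesis;
no claim on `abc`. [cite: PastenShimura2024, Cor 7.8 (GRH clause), §3 (Frey–Hellegouarch curves), arXiv pp. 13, 27] [cite: MurtyPasten2013, §8] -/
theorem abc_log_le_totient_rad_mul_loglog_of_thm_7_7_grh (h77 : PastenShimura2024_thm_7_7_grh)
    (hGRH : ∀ (N₁ N₂ : ℕ) [NeZero N₁] [NeZero N₂] (f : CuspForm (Gamma0 N₁) 2)
      (g : CuspForm (Gamma0 N₂) 2), IsNewform0 f → IsNewform0 g → RankinSelbergGRH f g) :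
    ∃ c₀ : ℝ, ∀ a b c : ℕ, IsABCTriple a b c → c₀ ≤ (c : ℝ) →
      Real.log c ≤ 2051 * (Nat.totient (rad a b c) : ℝ) * Real.log (Real.log (rad a b c : ℝ)) := by
  classical
  set v₂ : HeightOneSpectrum ℤ := (primesEquiv (R := ℤ)).symm ⟨2, Nat.prime_two⟩ with hv₂
  obtain ⟨N₀, hN₀⟩ := PastenShimura2024_cor_7_8_grh h77 hGRH {v₂} (show (0 : ℝ) < 1 / 2 by norm_num)
  -- the factor `P/φ(P) = 2`
  have hPφ : (∏ v ∈ ({v₂} : Finset (HeightOneSpectrum ℤ)), (Ideal.absNorm v.asIdeal : ℝ)) /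
      (Nat.totient (∏ v ∈ ({v₂} : Finset (HeightOneSpectrum ℤ)), Ideal.absNorm v.asIdeal) : ℝ) = 2 := by
    have h2 : Ideal.absNorm v₂.asIdeal = 2 := by
      rw [hv₂, absNorm_asIdeal_primesEquiv_symm]
    rw [prod_singleton, prod_singleton, h2, Nat.totient_prime Nat.prime_two]
    norm_num
  set M : ℕ := max (N₀ + 2) 512 with hM
  -- Mahler: the triples all of whose primes are `< 2M` form a finite set; bound their `c`
  have hfin := finite_setOf_isABCTriple_primeFactors_subset_holds (Finset.range (2 * M))
  obtain ⟨B, hB⟩ := (hfin.image fun t : ℕ × ℕ × ℕ => t.2.2).bddAbove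
  refine ⟨(B : ℝ) + 1, fun a b c ht hc₀ => ?_⟩
  have ht' := ht
  obtain ⟨ha, hb, habc, hcop⟩ := ht'
  have hc : 0 < c := by omega
  -- a prime factor `p ≥ 2M` of `abc`
  have hnot : ¬ (a * b * c).primeFactors ⊆ Finset.range (2 * M) := by
    intro hsub
    have hmem : c ∈ (fun t : ℕ × ℕ × ℕ => t.2.2) ''
        {t : ℕ × ℕ × ℕ | IsABCTriple t.1 t.2.1 t.2.2 ∧
          (t.1 * t.2.1 * t.2.2).primeFactors ⊆ Finset.range (2 * M)} :=
      ⟨(a, b, c), ⟨ht, hsub⟩, rfl⟩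
    have h1 : c ≤ B := hB hmem
    have h2 : (c : ℝ) ≤ B := by exact_mod_cast h1
    linarith
  obtain ⟨p, hp, hpM⟩ := Finset.not_subset.mp hnot
  have hpP : p.Prime := Nat.prime_of_mem_primeFactors hp
  have hpdvd : p ∣ a * b * c := Nat.dvd_of_mem_primeFactors hp
  have hp2M : 2 * M ≤ p := by simpa [Finset.mem_range] using hpM
  have hM512 : 512 ≤ M := le_max_right _ _
  have hMN₀ : N₀ + 2 ≤ M := le_max_left _ _
  -- `p ≤ rad(abc)`, so `rad ≥ 1024`; `rad` is squarefree
  have hprad : p ≤ rad a b c := by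
    apply Nat.le_of_mem_primeFactors
    rw [rad_def, Nat.primeFactors_radical]
    exact hp
  have hrad1024 : 1024 ≤ rad a b c := by omega
  have hradsq : Squarefree (rad a b c) := by rw [rad_def]; exact squarefree_radical
  -- the Frey model, its global minimal model, a Néron lattice
  obtain ⟨W₀, hE, hN, hΔ⟩ := exists_frey_model_sq_dvd ht
  haveI := hE
  set Wq : WeierstrassCurve ℚ := W₀.baseChange ℚ with hWq
  obtain ⟨C, hC⟩ := hasGlobalMinimalModel_rat_holds Wq
  haveI := hC
  obtain ⟨L, hL⟩ := exists_isNeronLatticeOf_holds ((C • Wq).baseChange ℂ)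
  have hNeq : (C • Wq).conductorNorm ℤ = Wq.conductorNorm ℤ := conductorNorm_smul_rat Wq C
  have hΔeq : (C • Wq).minimalDiscriminantNorm ℤ = Wq.minimalDiscriminantNorm ℤ :=
    minimalDiscriminantNorm_smul_rat Wq C
  have hΔpos : 0 < Wq.minimalDiscriminantNorm ℤ := minimalDiscriminantNorm_pos_holds _
  have hNpos : 0 < Wq.conductorNorm ℤ := conductorNorm_pos_holds _
  -- `p ∣ Δ_min`, hence `p ∣ N`, so `N ≥ N₀` and `N ≥ 1024`
  have hp2 : p ≠ 2 := by omega
  have hpΔ : p ∣ Wq.minimalDiscriminantNorm ℤ := by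
    have h1 : p ∣ 2 ^ 8 * Wq.minimalDiscriminantNorm ℤ :=
      hpdvd.trans ((dvd_pow_self _ two_ne_zero).trans hΔ)
    have hcop2 : Nat.Coprime p (2 ^ 8) :=
      Nat.Coprime.pow_right 8 ((Nat.coprime_primes hpP Nat.prime_two).mpr hp2)
    exact hcop2.dvd_of_dvd_mul_left h1
  have hpN : p ∈ (Wq.conductorNorm ℤ).primeFactors := by
    have hrad := Wq.radical_conductorNorm_eq_holds
    rw [natRadical_eq_iff] at hrad
    rw [hrad]
    exact Nat.mem_primeFactors.mpr ⟨hpP, hpΔ, hΔpos.ne'⟩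
  have hpleN : p ≤ Wq.conductorNorm ℤ := Nat.le_of_mem_primeFactors hpN
  have hNge : N₀ ≤ Wq.conductorNorm ℤ := le_trans (by omega) (hp2M.trans hpleN)
  have hN1024 : 1024 ≤ Wq.conductorNorm ℤ := le_trans (by omega) (hp2M.trans hpleN)
  -- semistable away from `2`, and the GRH discriminant bound
  have hss : ∀ v : HeightOneSpectrum ℤ, v ∉ ({v₂} : Finset (HeightOneSpectrum ℤ)) →
      (C • Wq).IsSemistableAt v := fun v hv ↦
    isSemistableAt_of_dvd_two_pow_mul (C • Wq) hradsq (by rw [hNeq]; exact hN) v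
      (by simpa using hv)
  have hbound := (hN₀ (C • Wq) L hL hss (by rw [hNeq]; exact hNge)).2
  rw [hPφ, hNeq, hΔeq] at hbound
  -- `φ(N) ≤ 1024 φ(rad)`
  have hφ : (Nat.totient (Wq.conductorNorm ℤ) : ℝ) ≤ 1024 * (Nat.totient (rad a b c) : ℝ) := by
    have h1 : Nat.totient (Wq.conductorNorm ℤ) ∣ Nat.totient (2 ^ 10 * rad a b c) :=
      Nat.totient_dvd_of_dvd hN
    have h2 : Nat.totient (Wq.conductorNorm ℤ) ≤ Nat.totient (2 ^ 10 * rad a b c) :=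
      Nat.le_of_dvd (Nat.totient_pos.2 (by positivity)) h1
    have h3 := totient_two_pow_mul_le hradsq
    have h4 : Nat.totient (Wq.conductorNorm ℤ) ≤ 2 ^ 10 * Nat.totient (rad a b c) := h2.trans h3
    exact_mod_cast h4
  have hφ1 : (1 : ℝ) ≤ (Nat.totient (rad a b c) : ℝ) := by
    exact_mod_cast Nat.totient_pos.2 (by omega)
  -- real-number bookkeeping
  have hR : (1024 : ℝ) ≤ (rad a b c : ℝ) := by exact_mod_cast hrad1024
  have hN1024' : (1024 : ℝ) ≤ (Wq.conductorNorm ℤ : ℝ) := by exact_mod_cast hN1024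
  have hD0 : (0 : ℝ) < (Wq.minimalDiscriminantNorm ℤ : ℝ) := by exact_mod_cast hΔpos
  have hNR : (Wq.conductorNorm ℤ : ℝ) ≤ 1024 * (rad a b c : ℝ) := by
    have hradpos : 0 < rad a b c := by omega
    have := Nat.le_of_dvd (mul_pos (by positivity) hradpos) hN
    exact_mod_cast this
  have hc2 : (c : ℝ) ^ 2 ≤ 2 ^ 8 * (Wq.minimalDiscriminantNorm ℤ : ℝ) := by
    have h1 : c ≤ a * b * c := Nat.le_mul_of_pos_left c (by positivity)
    have h2 : (a * b * c) ^ 2 ≤ 2 ^ 8 * Wq.minimalDiscriminantNorm ℤ :=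
      Nat.le_of_dvd (by positivity) hΔ
    have h3 : c ^ 2 ≤ 2 ^ 8 * Wq.minimalDiscriminantNorm ℤ := (Nat.pow_le_pow_left h1 2).trans h2
    exact_mod_cast h3
  set N : ℝ := (Wq.conductorNorm ℤ : ℝ) with hNdef
  set D : ℝ := (Wq.minimalDiscriminantNorm ℤ : ℝ) with hDdef
  set R : ℝ := (rad a b c : ℝ) with hRdef
  set φN : ℝ := (Nat.totient (Wq.conductorNorm ℤ) : ℝ) with hφNdef
  set φR : ℝ := (Nat.totient (rad a b c) : ℝ) with hφRdef
  have hl2 := Real.log_two_lt_d9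
  have hl2' := Real.log_two_gt_d9
  have hR0 : (0 : ℝ) < R := by linarith
  have hNpos' : (0 : ℝ) < N := by linarith
  have hlogc : 2 * Real.log c ≤ 8 * Real.log 2 + Real.log D := by
    have h1 : Real.log ((c : ℝ) ^ 2) ≤ Real.log (2 ^ 8 * D) :=
      Real.log_le_log (by positivity) hc2
    rw [Real.log_pow, Real.log_mul (by positivity) hD0.ne', Real.log_pow] at h1
    push_cast at h1
    linarith
  -- `log R ≥ 6.9`, hence `log log R ≥ 1`
  have h1024 : Real.log 1024 = 10 * Real.log 2 := by
    rw [show (1024 : ℝ) = 2 ^ 10 by norm_num, Real.log_pow]; norm_num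
  have hlogR : 6.9 ≤ Real.log R := by
    have h1 : Real.log 1024 ≤ Real.log R := Real.log_le_log (by norm_num) hR
    rw [h1024] at h1
    linarith
  have hlogRpos : 0 < Real.log R := by linarith
  have hLLR1 : 1 ≤ Real.log (Real.log R) := by
    rw [Real.le_log_iff_exp_le hlogRpos]
    have he := Real.exp_one_lt_d9
    linarith
  have hLLR0 : 0 ≤ Real.log (Real.log R) := by linarith
  -- `log N ≤ 2 log R`, so `log log N ≤ log 2 + log log R ≤ 2 log log R`
  have hNR2 : N ≤ R ^ 2 :=
    calc N ≤ 1024 * R := hNR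
      _ ≤ R * R := mul_le_mul_of_nonneg_right hR hR0.le
      _ = R ^ 2 := (sq R).symm
  have hlogN : Real.log N ≤ 2 * Real.log R := by
    have h1 : Real.log N ≤ Real.log (R ^ 2) := Real.log_le_log hNpos' hNR2
    have h2 : Real.log (R ^ 2) = 2 * Real.log R := by rw [Real.log_pow]; norm_num
    linarith
  have hlogNone : 1 ≤ Real.log N := by
    have h1 : Real.log 1024 ≤ Real.log N := Real.log_le_log (by norm_num) hN1024'
    rw [h1024] at h1
    linarith
  have hlogNpos : 0 < Real.log N := by linarith
  have hLLN : Real.log (Real.log N) ≤ 2 * Real.log (Real.log R) := by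
    calc Real.log (Real.log N) ≤ Real.log (2 * Real.log R) := Real.log_le_log hlogNpos hlogN
      _ = Real.log 2 + Real.log (Real.log R) := Real.log_mul (by norm_num) hlogRpos.ne'
      _ ≤ 2 * Real.log (Real.log R) := by linarith
  have hLLN0 : 0 ≤ Real.log (Real.log N) := Real.log_nonneg hlogNone
  -- `log D < 2 φ(N) log log N ≤ 4096 φ(R) log log R`
  have hD1 : Real.log D < 2 * (1 / 2 + 1 / 2) * φN * Real.log (Real.log N) := hbound
  have hD2 : φN * Real.log (Real.log N) ≤ (1024 * φR) * (2 * Real.log (Real.log R)) :=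
    mul_le_mul hφ hLLN hLLN0 (by positivity)
  have h4 : 4 * Real.log 2 ≤ 3 * (φR * Real.log (Real.log R)) := by
    have h1 : (1 : ℝ) * 1 ≤ φR * Real.log (Real.log R) := mul_le_mul hφ1 hLLR1 zero_le_one (by linarith)
    linarith
  have e1 : 2 * (1 / 2 + 1 / 2) * φN * Real.log (Real.log N) = 2 * (φN * Real.log (Real.log N)) := by
    ring
  rw [e1] at hD1
  have hmain : Real.log c ≤ 4 * Real.log 2 + 2048 * (φR * Real.log (Real.log R)) := by
    linarith
  calc Real.log c ≤ 4 * Real.log 2 + 2048 * (φR * Real.log (Real.log R)) := hmain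
    _ ≤ 3 * (φR * Real.log (Real.log R)) + 2048 * (φR * Real.log (Real.log R)) := by linarith
    _ = 2051 * φR * Real.log (Real.log R) := by ring

end Abc

end Literature.NumberTheory.EllipticCurves.ModularForms

end
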